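import Summits.NavierStokesRegularity.NavierStokesRegularity.Theorems.StrainDoorsSpacetimeRecords
import HarnessLib

/-!
# StrainDoorsVorticityRecord — THE VORTICITY RECORD LAW (the `ξ`-twin of the running-record law)

nsreg-p1 g35, ROUND-53 PART 1 (helper lane of `stmt-NavierStokesRegularity-0056`, rung N0; 0 ledger writes by the
planner — text for the S-lane to land `--supports stmt-NavierStokesRegularity-0056 --as helper`).

ROUND-52 priced every new high of the STRAIN number `(T − t)·λ₁`.  This file prices every new high of the
VORTICITY number `(T − t)·|ω|` — and the price is paid in the FINE STRUCTURE of the vorticity direction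
`ξ = ω/|ω|`: the stretching rate in the vorticity direction must beat `1/(T − t)` PLUS the viscous twist
`ν|∇ξ|²_F` (Constantin's geometric-depletion quantity, read at one point).

Classical solution `(u,p)` of the unforced Navier–Stokes equations on a time set `S` of unique differentiability
(`ν ≥ 0`), an interior time `t` (`S ∈ 𝓝 t`), a point `x` with `ω(t,x) ≠ 0`, ANY reference time `T > t`;
`α(t,x) = ⟪ξ, ∇u ξ⟫` (`= strainQuad u t x ξ`), `|∇ξ|²_F = frobeniusNormSq (fderiv ℝ (vorticityDirection ω) x)`.

* §1 `vorticityNumber_fermat_left` — one-sided Fermat in time: if `s ↦ (T − s)·|ω(s,x)|` has a LEFT local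
  maximum at `t` (a running record at the frozen point `x`), then `|ω|² ≤ (T − t)·⟪ω, ∂ₜω⟫` at `(t,x)`.
* §2 ★★ `vorticity_record_law` — if moreover `x` is a spatial maximum of `|ω(t,·)|`, then
  `1 ≤ (T − t)·(α − ν|∇ξ|²_F)` at `(t,x)`:  **at every running record of the vorticity number the stretching
  rate in the vorticity direction exceeds `1/(T − t)` by the viscous twist.**  (GGH97's magnitude equation at the
  argmax, tree plate `ArgmaxDoors.inner_vorticity_rhs_le_at_argmax`, + §1.)  Filter form `vorticity_running_record_law`.
* §2 ★ `strainNumber_floor_at_vorticity_record` — the same read on the STRAIN side: `ξ(t,x)` is a unit vector and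
  `1 + ν(T − t)|∇ξ|²_F ≤ (T − t)·q(t,x,ξ)`, so every majorant `M` of the strain number density at time `t`
  (`(T − t)·q(t,y,e') ≤ M` for all `y`, unit `e'`; e.g. `M = (T − t)·Λ(t)`) obeys `1 + ν(T − t)|∇ξ(t,x)|²_F ≤ M`
  (`strainNumber_majorant_ge_at_vorticity_record`): **the strain number exceeds the BKM threshold `1` by the scaled
  twist at every vorticity record.**
* §3 ★ `vorticity_running_max_law` — the `T = ∞` form: at a running maximum of `|ω|` itself (no reference time),
  `ν|∇ξ|²_F ≤ α`: the twist never exceeds the stretching at a new high of the vorticity max-norm (DNS-checkable).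

WHAT THIS IS NOT: no blow-up or profile is excluded; `0056`/NS regularity are not proved; a necessary condition AT
records, constant exactly `1`, frame-free.  No new definitions; no sorry.
[cite: GalantiGibbonHeritage1997, §3 (Dw1), (Dw4) (arXiv:chao-dyn/9709003 p. 7); ConstantinFefferman1993, §1;
BealeKatoMajda1984, §1]
-/

noncomputable section

open MeasureTheory Set Function Filter Metric Real InnerProductSpace
open _root_.Topology
open scoped ENNReal NNReal RealInnerProductSpace ContDiff Laplacian
open Literature.Analysis Literature.Analysis.FluidPDE
open Literature.Analysis.FluidPDE.VorticityDirectionDynamics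

set_option linter.dupNamespace false

namespace Summit.NavierStokesRegularity.NavierStokesRegularity.Theorems.StrainDoors

open Summit.NavierStokesRegularity.NavierStokesRegularity.Theorems.ArgmaxDoors

-- nested operator types (second derivatives of the vorticity direction)
set_option maxSynthPendingDepth 3

/-! ## §1 One-sided Fermat in time for the vorticity number at a frozen point -/

/-- **One-sided Fermat for the vorticity number.**  `u` jointly smooth on `S` (unique differentiability),
`S ∈ 𝓝 t`, `t < T`, a point `x`.  If `s ↦ (T − s)·|ω(s,x)|` has a LEFT local maximum at `t` (its value at `t`
dominates its recent past at the frozen point `x`), then `|ω(t,x)|² ≤ (T − t)·⟪ω(t,x), ∂ₜω(t,x)⟫`, where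
`∂ₜω = timeDerivWithin S (vorticity u) t x`.  (Square the record function to make it differentiable:
`F(s) = (T − s)²|ω(s,x)|²` has a left local maximum, `F'(t) = −2(T − t)|ω|² + 2(T − t)²⟪ω,∂ₜω⟫ ≥ 0`.) [folklore] -/
theorem vorticityNumber_fermat_left {S : Set ℝ}
    {u : ℝ → (EuclideanSpace ℝ (Fin 3)) → (EuclideanSpace ℝ (Fin 3))}
    (h : IsSmoothSpaceTimeOn S u) (hS : UniqueDiffOn ℝ S) {t T : ℝ} (ht : S ∈ 𝓝 t) (htT : t < T)
    (x : EuclideanSpace ℝ (Fin 3))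
    (hrec : IsLocalMaxOn (fun s => (T - s) * ‖curl (u s) x‖) (Iic t) t) :
    ‖curl (u t) x‖ ^ 2 ≤ (T - t) * ⟪curl (u t) x, timeDerivWithin S (vorticity u) t x⟫ := by
  have ht' : t ∈ S := mem_of_mem_nhds ht
  have hTt : 0 < T - t := sub_pos.mpr htT
  have hω : IsSmoothSpaceTimeOn S (vorticity u) := (h.fderiv_slice hS).clm_comp curlCLM
  obtain ⟨w, hwdef⟩ : ∃ w, w = timeDerivWithin S (vorticity u) t x := ⟨_, rfl⟩
  have hd : HasDerivAt (fun s => curl (u s) x) w t := by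
    rw [hwdef]
    exact (hω.hasDerivWithinAt_timeDerivWithin hS ht' x).hasDerivAt ht
  -- `g(s) = |ω(s,x)|²`, `g'(t) = 2⟪ω, w⟫`
  have hg : HasDerivAt (fun s => ‖curl (u s) x‖ ^ 2) (2 * ⟪curl (u t) x, w⟫) t := hd.norm_sq
  -- `F(s) = (T − s)(T − s) g(s)`
  have hl : HasDerivAt (fun s : ℝ => T - s) (-1) t := by
    simpa using (hasDerivAt_id t).const_sub T
  have hF : HasDerivAt (fun s => (T - s) * (T - s) * ‖curl (u s) x‖ ^ 2)
      ((-1 * (T - t) + (T - t) * -1) * ‖curl (u t) x‖ ^ 2 + (T - t) * (T - t) * (2 * ⟪curl (u t) x, w⟫)) t :=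
    (hl.mul hl).mul hg
  -- `F` has a left local maximum at `t`
  have hrecF : IsLocalMaxOn (fun s => (T - s) * (T - s) * ‖curl (u s) x‖ ^ 2) (Iic t) t := by
    show ∀ᶠ s in 𝓝[Iic t] t,
      (T - s) * (T - s) * ‖curl (u s) x‖ ^ 2 ≤ (T - t) * (T - t) * ‖curl (u t) x‖ ^ 2
    filter_upwards [hrec, self_mem_nhdsWithin] with s hs hsle
    have hsT : s < T := lt_of_le_of_lt hsle htT
    have h0 : 0 ≤ (T - s) * ‖curl (u s) x‖ := mul_nonneg (sub_pos.mpr hsT).le (norm_nonneg _)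
    have h2 := mul_self_le_mul_self h0 hs
    have e1 : ∀ r : ℝ, (T - r) * ‖curl (u r) x‖ * ((T - r) * ‖curl (u r) x‖) =
        (T - r) * (T - r) * ‖curl (u r) x‖ ^ 2 := fun r => by ring
    rw [e1, e1] at h2
    exact h2
  have hnn := hasDerivAt_nonneg_of_isLocalMaxOn_Iic hrecF hF
  rw [← hwdef]
  -- `0 ≤ 2(T − t)·((T − t)⟪ω,w⟫ − |ω|²)`
  have key : ‖curl (u t) x‖ ^ 2 * (T - t) ≤ (T - t) * ⟪curl (u t) x, w⟫ * (T - t) := by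
    linarith [hnn]
  exact le_of_mul_le_mul_right key hTt

/-! ## §2 The vorticity record law and the strain-number floor at a vorticity record -/

/-- ★★ **THE VORTICITY RECORD LAW.**  Classical unforced solution on `S` (unique differentiability, `ν ≥ 0`),
interior time `t < T`, a point `x` with `ω(t,x) ≠ 0` which is (i) a spatial maximum of `|ω(t,·)|` and (ii) a LEFT
local maximum in time of `s ↦ (T − s)|ω(s,x)|` (together: a running space-time record of the vorticity number).
Then, with `ξ = ω/|ω|`, `α = ⟪ξ, ∇u ξ⟫`:
`1 ≤ (T − t)·(α(t,x) − ν|∇ξ(t,x)|²_F)`.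
Proof: §1 gives `|ω|² ≤ (T − t)⟪ω, ∂ₜω⟫`; the vorticity equation and the magnitude computation at the spatial
maximum (`inner_vorticity_rhs_le_at_argmax`: transport term vanishes, `⟪ω,Δω⟫ ≤ −|ω|²|∇ξ|²_F`) give
`⟪ω, ∂ₜω⟫ ≤ (α − ν|∇ξ|²_F)|ω|²`; divide by `|ω|² > 0`. [folklore] -/
theorem vorticity_record_law {ν T : ℝ} {S : Set ℝ}
    {u : ℝ → (EuclideanSpace ℝ (Fin 3)) → (EuclideanSpace ℝ (Fin 3))} {p : ℝ → (EuclideanSpace ℝ (Fin 3)) → ℝ}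
    (hν : 0 ≤ ν) (hS : UniqueDiffOn ℝ S) (hsol : IsClassicalNSSolutionOn S ν 0 u p)
    {t : ℝ} (ht : S ∈ 𝓝 t) (htT : t < T) {x : EuclideanSpace ℝ (Fin 3)}
    (hmaxX : ∀ y, ‖curl (u t) y‖ ≤ ‖curl (u t) x‖)
    (hmaxT : IsLocalMaxOn (fun s => (T - s) * ‖curl (u s) x‖) (Iic t) t)
    (hne : curl (u t) x ≠ 0) :
    1 ≤ (T - t) *
      (⟪vorticityDirection (curl (u t)) x, fderiv ℝ (u t) x (vorticityDirection (curl (u t)) x)⟫ -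
        ν * frobeniusNormSq (fderiv ℝ (vorticityDirection (curl (u t))) x)) := by
  have ht' : t ∈ S := mem_of_mem_nhds ht
  have hTt : 0 < T - t := sub_pos.mpr htT
  have hv : ContDiff ℝ ∞ (u t) := hsol.contDiff_velocity ht'
  have hvort := (hsol.isVorticitySolutionOn_of_uniqueDiffOn hS (fun s _ y => curl_zero y)).vorticity_eq t ht' x
  have h1 := inner_vorticity_rhs_le_at_argmax hν hv hmaxX hne hvort
  have h2 := vorticityNumber_fermat_left hsol.smooth_velocity hS ht htT x hmaxT
  have hpos : 0 < ‖curl (u t) x‖ ^ 2 := pow_pos (norm_pos_iff.mpr hne) 2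
  obtain ⟨r, hrdef⟩ : ∃ r : ℝ, r =
      ⟪vorticityDirection (curl (u t)) x, fderiv ℝ (u t) x (vorticityDirection (curl (u t)) x)⟫ -
        ν * frobeniusNormSq (fderiv ℝ (vorticityDirection (curl (u t))) x) := ⟨_, rfl⟩
  rw [← hrdef] at h1 ⊢
  have h3 : ‖curl (u t) x‖ ^ 2 ≤ (T - t) * (r * ‖curl (u t) x‖ ^ 2) :=
    h2.trans (mul_le_mul_of_nonneg_left h1 hTt.le)
  have h4 : 1 * ‖curl (u t) x‖ ^ 2 ≤ (T - t) * r * ‖curl (u t) x‖ ^ 2 := by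
    rw [one_mul, mul_assoc]; exact h3
  exact le_of_mul_le_mul_right h4 hpos

/-- ★★ **Filter form (a running record of the vorticity number).**  If the vorticity number at `(t,x)` DOMINATES
ITS RECENT PAST — for all times `s ≤ t` close to `t` and all `y`, `(T − s)|ω(s,y)| ≤ (T − t)|ω(t,x)|` (every new
all-time high of `(T − t)‖ω(t)‖_∞` attained in space is one) — and `ω(t,x) ≠ 0`, then
`1 ≤ (T − t)·(α − ν|∇ξ|²_F)` at `(t,x)`. [folklore] -/
theorem vorticity_running_record_law {ν T : ℝ} {S : Set ℝ}
    {u : ℝ → (EuclideanSpace ℝ (Fin 3)) → (EuclideanSpace ℝ (Fin 3))} {p : ℝ → (EuclideanSpace ℝ (Fin 3)) → ℝ}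
    (hν : 0 ≤ ν) (hS : UniqueDiffOn ℝ S) (hsol : IsClassicalNSSolutionOn S ν 0 u p)
    {t : ℝ} (ht : S ∈ 𝓝 t) (htT : t < T) {x : EuclideanSpace ℝ (Fin 3)}
    (hrec : ∀ᶠ s in 𝓝[≤] t, ∀ y : EuclideanSpace ℝ (Fin 3), (T - s) * ‖curl (u s) y‖ ≤ (T - t) * ‖curl (u t) x‖)
    (hne : curl (u t) x ≠ 0) :
    1 ≤ (T - t) *
      (⟪vorticityDirection (curl (u t)) x, fderiv ℝ (u t) x (vorticityDirection (curl (u t)) x)⟫ -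
        ν * frobeniusNormSq (fderiv ℝ (vorticityDirection (curl (u t))) x)) := by
  have hTt : 0 < T - t := sub_pos.mpr htT
  have hnow := hrec.self_of_nhdsWithin (mem_Iic.mpr le_rfl)
  have hmaxX : ∀ y, ‖curl (u t) y‖ ≤ ‖curl (u t) x‖ := fun y =>
    le_of_mul_le_mul_left (hnow y) hTt
  have hmaxT : IsLocalMaxOn (fun s => (T - s) * ‖curl (u s) x‖) (Iic t) t := by
    show ∀ᶠ s in 𝓝[Iic t] t, (T - s) * ‖curl (u s) x‖ ≤ (T - t) * ‖curl (u t) x‖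
    filter_upwards [hrec] with s hs
    exact hs x
  exact vorticity_record_law hν hS hsol ht htT hmaxX hmaxT hne

/-- ★ **THE STRAIN-NUMBER FLOOR AT A VORTICITY RECORD.**  In the situation of `vorticity_record_law`, the
vorticity direction `ξ = ξ(t,x)` is a unit vector and the strain number density in the direction `ξ` obeys
`1 + ν(T − t)|∇ξ(t,x)|²_F ≤ (T − t)·q(t,x,ξ)`  (`q(t,x,ξ) = ⟪∇u(t,x)ξ, ξ⟫ = α(t,x)`).
The excess of the strain number over the BKM threshold `1` pays for the twist of the vorticity lines. [folklore] -/
theorem strainNumber_floor_at_vorticity_record {ν T : ℝ} {S : Set ℝ}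
    {u : ℝ → (EuclideanSpace ℝ (Fin 3)) → (EuclideanSpace ℝ (Fin 3))} {p : ℝ → (EuclideanSpace ℝ (Fin 3)) → ℝ}
    (hν : 0 ≤ ν) (hS : UniqueDiffOn ℝ S) (hsol : IsClassicalNSSolutionOn S ν 0 u p)
    {t : ℝ} (ht : S ∈ 𝓝 t) (htT : t < T) {x : EuclideanSpace ℝ (Fin 3)}
    (hmaxX : ∀ y, ‖curl (u t) y‖ ≤ ‖curl (u t) x‖)
    (hmaxT : IsLocalMaxOn (fun s => (T - s) * ‖curl (u s) x‖) (Iic t) t)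
    (hne : curl (u t) x ≠ 0) :
    ‖vorticityDirection (curl (u t)) x‖ = 1 ∧
      1 + ν * (T - t) * frobeniusNormSq (fderiv ℝ (vorticityDirection (curl (u t))) x) ≤
        (T - t) * strainQuad u t x (vorticityDirection (curl (u t)) x) := by
  refine ⟨norm_vorticityDirection _ hne, ?_⟩
  have h := vorticity_record_law hν hS hsol ht htT hmaxX hmaxT hne
  have hcomm : strainQuad u t x (vorticityDirection (curl (u t)) x) =
      ⟪vorticityDirection (curl (u t)) x, fderiv ℝ (u t) x (vorticityDirection (curl (u t)) x)⟫ := by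
    unfold strainQuad
    rw [real_inner_comm]
  rw [hcomm]
  linarith

/-- ★ **Every majorant of the strain number is at least `1 + scaled twist` at a vorticity record.**  If `M`
majorises the strain number density at time `t` — `(T − t)·q(t,y,e') ≤ M` for all `y` and all unit `e'` (e.g.
`M = (T − t)·Λ(t)`, or the space-time supremum) — then at a running vorticity record `(t,x)`:
`1 + ν(T − t)|∇ξ(t,x)|²_F ≤ M`, in particular `1 ≤ M`. [folklore] -/
theorem strainNumber_majorant_ge_at_vorticity_record {ν T : ℝ} {S : Set ℝ}
    {u : ℝ → (EuclideanSpace ℝ (Fin 3)) → (EuclideanSpace ℝ (Fin 3))} {p : ℝ → (EuclideanSpace ℝ (Fin 3)) → ℝ}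
    (hν : 0 ≤ ν) (hS : UniqueDiffOn ℝ S) (hsol : IsClassicalNSSolutionOn S ν 0 u p)
    {t : ℝ} (ht : S ∈ 𝓝 t) (htT : t < T) {x : EuclideanSpace ℝ (Fin 3)}
    (hmaxX : ∀ y, ‖curl (u t) y‖ ≤ ‖curl (u t) x‖)
    (hmaxT : IsLocalMaxOn (fun s => (T - s) * ‖curl (u s) x‖) (Iic t) t)
    (hne : curl (u t) x ≠ 0) {M : ℝ}
    (hM : ∀ (y e' : EuclideanSpace ℝ (Fin 3)), ‖e'‖ = 1 → (T - t) * strainQuad u t y e' ≤ M) :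
    1 + ν * (T - t) * frobeniusNormSq (fderiv ℝ (vorticityDirection (curl (u t))) x) ≤ M ∧ 1 ≤ M := by
  obtain ⟨hξ, hfloor⟩ := strainNumber_floor_at_vorticity_record hν hS hsol ht htT hmaxX hmaxT hne
  have h1 := hfloor.trans (hM x _ hξ)
  have hF : 0 ≤ frobeniusNormSq (fderiv ℝ (vorticityDirection (curl (u t))) x) := frobeniusNormSq_nonneg _
  have hTt : 0 < T - t := sub_pos.mpr htT
  have hprod : 0 ≤ ν * (T - t) * frobeniusNormSq (fderiv ℝ (vorticityDirection (curl (u t))) x) :=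
    mul_nonneg (mul_nonneg hν hTt.le) hF
  exact ⟨h1, by linarith⟩

/-! ## §3 The `T = ∞` form: a running maximum of the vorticity max-norm itself -/

/-- ★ **THE RUNNING-MAXIMUM LAW FOR THE VORTICITY** (no reference time).  Classical unforced solution on `S`
(`ν ≥ 0`), interior time `t`, `ω(t,x) ≠ 0`.  If `|ω(t,x)|` dominates `|ω(s,y)|` for all `y` and all times `s ≤ t`
close to `t` — a running maximum of `‖ω(s)‖_∞`, attained at `x` — then the twist does not exceed the stretching
there:  `ν|∇ξ(t,x)|²_F ≤ α(t,x) = ⟪ξ, ∇u ξ⟫`.  (One-sided Fermat `⟪ω,∂ₜω⟫ ≥ 0` + the magnitude computation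
at the argmax.)  A DNS-checkable necessary condition at every new high of the vorticity max-norm. [folklore] -/
theorem vorticity_running_max_law {ν : ℝ} {S : Set ℝ}
    {u : ℝ → (EuclideanSpace ℝ (Fin 3)) → (EuclideanSpace ℝ (Fin 3))} {p : ℝ → (EuclideanSpace ℝ (Fin 3)) → ℝ}
    (hν : 0 ≤ ν) (hS : UniqueDiffOn ℝ S) (hsol : IsClassicalNSSolutionOn S ν 0 u p)
    {t : ℝ} (ht : S ∈ 𝓝 t) {x : EuclideanSpace ℝ (Fin 3)}
    (hrec : ∀ᶠ s in 𝓝[≤] t, ∀ y : EuclideanSpace ℝ (Fin 3), ‖curl (u s) y‖ ≤ ‖curl (u t) x‖)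
    (hne : curl (u t) x ≠ 0) :
    ν * frobeniusNormSq (fderiv ℝ (vorticityDirection (curl (u t))) x) ≤
      ⟪vorticityDirection (curl (u t)) x, fderiv ℝ (u t) x (vorticityDirection (curl (u t)) x)⟫ := by
  have ht' : t ∈ S := mem_of_mem_nhds ht
  have hv : ContDiff ℝ ∞ (u t) := hsol.contDiff_velocity ht'
  have hnow := hrec.self_of_nhdsWithin (mem_Iic.mpr le_rfl)
  have hmaxX : ∀ y, ‖curl (u t) y‖ ≤ ‖curl (u t) x‖ := fun y => hnow y
  have hvort := (hsol.isVorticitySolutionOn_of_uniqueDiffOn hS (fun s _ y => curl_zero y)).vorticity_eq t ht' x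
  have h1 := inner_vorticity_rhs_le_at_argmax hν hv hmaxX hne hvort
  -- one-sided Fermat for `g(s) = |ω(s,x)|²`
  have hω : IsSmoothSpaceTimeOn S (vorticity u) := (hsol.smooth_velocity.fderiv_slice hS).clm_comp curlCLM
  obtain ⟨w, hwdef⟩ : ∃ w, w = timeDerivWithin S (vorticity u) t x := ⟨_, rfl⟩
  have hd : HasDerivAt (fun s => curl (u s) x) w t := by
    rw [hwdef]
    exact (hω.hasDerivWithinAt_timeDerivWithin hS ht' x).hasDerivAt ht
  have hg : HasDerivAt (fun s => ‖curl (u s) x‖ ^ 2) (2 * ⟪curl (u t) x, w⟫) t := hd.norm_sq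
  have hrecg : IsLocalMaxOn (fun s => ‖curl (u s) x‖ ^ 2) (Iic t) t := by
    show ∀ᶠ s in 𝓝[Iic t] t, ‖curl (u s) x‖ ^ 2 ≤ ‖curl (u t) x‖ ^ 2
    filter_upwards [hrec] with s hs
    exact pow_le_pow_left₀ (norm_nonneg _) (hs x) 2
  have hnn := hasDerivAt_nonneg_of_isLocalMaxOn_Iic hrecg hg
  rw [← hwdef] at h1
  have hpos : 0 < ‖curl (u t) x‖ ^ 2 := pow_pos (norm_pos_iff.mpr hne) 2
  have h2 : 0 * ‖curl (u t) x‖ ^ 2 ≤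
      (⟪vorticityDirection (curl (u t)) x, fderiv ℝ (u t) x (vorticityDirection (curl (u t)) x)⟫ -
        ν * frobeniusNormSq (fderiv ℝ (vorticityDirection (curl (u t))) x)) * ‖curl (u t) x‖ ^ 2 := by
    rw [zero_mul]; linarith
  have h3 := le_of_mul_le_mul_right h2 hpos
  linarith

end Summit.NavierStokesRegularity.NavierStokesRegularity.Theorems.StrainDoors
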